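import Summits.ValiantsHypothesis.ValiantsHypothesis.Theorems.LacunarySymmetroidMatrixDescartesCensusCUCheck

/-!
# `MatrixDescartes` census — soundness of the chamber-uniform checker, part 1: exponent forms, Farkas certificates, position vectors, form weights, the ABEL step

HONEST FRAMING.  Object-search cell `pub-symmetroid`; door-A item `DoorA26 = PosRootLawAt 2 6 19`
(stmt-ValiantsHypothesis-19979; OPEN, typed, never asserted).  Part of the proof that a certificate accepted by `CU.checkChamber`
(`…CensusCUCheck`) excludes a twenty on every support of its chamber.  This file: the real/integer SEMANTICS of the bookkeeping objects —
values of exponent forms `LinD` at a support, soundness of Farkas certificates (`CU.farkasOK_sound`), dot products of position vectors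
with the log-absolute coefficients (`CU.vdot`, behaviour under `vbump(s)/vAdd/vSmul`, `suffixSums`, `prefixForm`), and sums of
form weights (`CU.fwSum` under `fwIns`); then the ABEL STEP as pure real analysis of sequences: for points `(E_t, A_t)`,
`t = 0 … 20`, in concave position and a weight vector `b` with `Σ b_t = 0` whose Abel prefix sums `C_j = Σ_{i<j} (Σ_{t>i} b_t)(E_{i+1} − E_i)`
satisfy `C_j ≤ 0` (`j = 1 … 19`) and `C_20 = 0`, the pairing `Σ b_t A_t` is `≤ 0` (`CU.abel_nonpos`, the step every gen4/gen7 `…Abel`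
file replays with 19 slope variables), and the checker-facing corollary `CU.abelOK_sound`.  Elementary; nothing here mentions pencils.  Nothing here bears on `V = 19`, on
`DoorA26` itself (OPEN), on `MatrixDescartes` (stmt-ValiantsHypothesis-18050) or on `VP ≠ VNP`.

[folklore] Certificate-checker soundness; elementary.
-/

-- the D-0017 layout repeats a namespace component (single-conjunct summit); the `dupNamespace` linter flags it; name mandated.
set_option linter.dupNamespace false

namespace Summit.ValiantsHypothesis.ValiantsHypothesis.Theorems.LacunarySymmetroidMatrixDescartes.Census.CU

open V20 (Atom)
open Finset

/-! ## Exponent forms -/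

/-- Integer value of a form at a support `d`. [folklore] -/
def LinD.ev (F : LinD) (d : Fin 6 → ℕ) : ℤ :=
  F.c0 * d 0 + F.c1 * d 1 + F.c2 * d 2 + F.c3 * d 3 + F.c4 * d 4 + F.c5 * d 5

variable (d : Fin 6 → ℕ)

/-- Value of the zero form. [folklore] -/
theorem ev_ld0 : ld0.ev d = 0 := by simp [LinD.ev, ld0]

/-- Value of a sum. [folklore] -/
theorem ev_ldAdd (F G : LinD) : (ldAdd F G).ev d = F.ev d + G.ev d := by
  simp only [LinD.ev, ldAdd]; ring

/-- Value of a scalar multiple. [folklore] -/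
theorem ev_ldSmul (z : ℤ) (F : LinD) : (ldSmul z F).ev d = z * F.ev d := by
  simp only [LinD.ev, ldSmul]; ring

/-- Value of a difference. [folklore] -/
theorem ev_ldSub (F G : LinD) : (ldSub F G).ev d = F.ev d - G.ev d := by
  rw [ldSub, ev_ldAdd, ev_ldSmul]; ring

/-- Value of a coordinate form. [folklore] -/
theorem ev_ldUnit {i : ℕ} (hi : i < 6) : (ldUnit i).ev d = d ⟨i, hi⟩ := by
  interval_cases i <;> simp [LinD.ev, ldUnit]

/-- Value of the pair-sum form of an atom with letters `< 6`. [folklore] -/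
theorem ev_atomForm {a : Atom} (h1 : a.1 < 6) (h2 : a.2 < 6) :
    (atomForm a).ev d = d ⟨a.1, h1⟩ + d ⟨a.2, h2⟩ := by
  rw [atomForm, ev_ldAdd, ev_ldUnit d h1, ev_ldUnit d h2]

/-- A natural combination of non-negative forms is non-negative. [folklore] -/
theorem ev_ctxComb_nonneg : ∀ (ctx : List LinD) (mu : List ℕ), (∀ F ∈ ctx, 0 ≤ F.ev d) → 0 ≤ (ctxComb ctx mu).ev d
  | [], [], _ => by simp [ctxComb, ev_ld0]
  | _ :: _, [], _ => by simp [ctxComb, ev_ld0]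
  | [], _ :: _, _ => by simp [ctxComb, ev_ld0]
  | F :: ctx, m :: mu, h => by
    rw [ctxComb, ev_ldAdd, ev_ldSmul]
    have hF : 0 ≤ F.ev d := h F (by simp)
    have hr := ev_ctxComb_nonneg ctx mu (fun G hG => h G (by simp [hG]))
    positivity

/-- **Soundness of a Farkas certificate**: the certified form is non-negative wherever the context forms are. [folklore] -/
theorem farkasOK_sound {ctx : List LinD} {F : LinD} {c : Fk} (h : farkasOK ctx F c = true)
    (hctx : ∀ G ∈ ctx, 0 ≤ G.ev d) : 0 ≤ F.ev d := by
  unfold farkasOK at h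
  simp only [Bool.and_eq_true, decide_eq_true_eq] at h
  obtain ⟨hnu, heq⟩ := h
  have h1 : 0 ≤ (ldSmul (c.nu : ℤ) F).ev d := by rw [heq]; exact ev_ctxComb_nonneg d ctx c.mu hctx
  rw [ev_ldSmul] at h1
  exact nonneg_of_mul_nonneg_right h1 (by exact_mod_cast hnu)

/-! ## Position vectors against a real valuation `ℓ` of the positions -/

/-- `Σ_i v_i · ℓ (k + i)`. [folklore] -/
def vdotFrom (ℓ : ℕ → ℝ) : List ℤ → ℕ → ℝ
  | [], _ => 0
  | a :: v, k => (a : ℝ) * ℓ k + vdotFrom ℓ v (k + 1)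

/-- `Σ_i v_i · ℓ i`. [folklore] -/
def vdot (v : List ℤ) (ℓ : ℕ → ℝ) : ℝ := vdotFrom ℓ v 0

variable (ℓ : ℕ → ℝ)

/-- `vdotFrom` as a `Finset` sum. [folklore] -/
theorem vdotFrom_eq_sum : ∀ (v : List ℤ) (k : ℕ), vdotFrom ℓ v k = ∑ i ∈ range v.length, (v.getD i 0 : ℝ) * ℓ (k + i)
  | [], k => by simp [vdotFrom]
  | a :: v, k => by
    rw [vdotFrom, vdotFrom_eq_sum v (k + 1), List.length_cons, sum_range_succ']
    simp only [List.getD_cons_succ, List.getD_cons_zero, add_zero, add_comm]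
    refine congrArg _ (sum_congr rfl fun i _ => ?_)
    rw [show i + (k + 1) = k + (i + 1) by omega]

/-- `vdot` as a `Finset` sum. [folklore] -/
theorem vdot_eq_sum (v : List ℤ) : vdot v ℓ = ∑ i ∈ range v.length, (v.getD i 0 : ℝ) * ℓ i := by
  rw [vdot, vdotFrom_eq_sum]; simp

/-- `vbump` keeps the length. [folklore] -/
theorem length_vbump : ∀ (v : List ℤ) (p : ℕ) (z : ℤ), (vbump v p z).length = v.length
  | [], _, _ => by simp [vbump]
  | _ :: _, 0, _ => by simp [vbump]
  | a :: v, p + 1, z => by simp [vbump, length_vbump v p z]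

/-- `vbump` adds `z · ℓ p`. [folklore] -/
theorem vdotFrom_vbump : ∀ (v : List ℤ) (k p : ℕ) (z : ℤ), p < v.length →
    vdotFrom ℓ (vbump v p z) k = vdotFrom ℓ v k + z * ℓ (k + p)
  | [], _, _, _, h => by simp at h
  | a :: v, k, 0, z, _ => by simp [vbump, vdotFrom]; ring
  | a :: v, k, p + 1, z, h => by
    have h' : p < v.length := by simpa using h
    rw [vbump, vdotFrom, vdotFrom, vdotFrom_vbump v (k + 1) p z h']
    ring_nf

/-- `vbump` adds `z · ℓ p`. [folklore] -/
theorem vdot_vbump {v : List ℤ} {p : ℕ} (z : ℤ) (h : p < v.length) : vdot (vbump v p z) ℓ = vdot v ℓ + z * ℓ p := by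
  rw [vdot, vdot, vdotFrom_vbump ℓ v 0 p z h, zero_add]

/-- `vbumps` keeps the length. [folklore] -/
theorem length_vbumps (ps : List ℕ) : ∀ (v : List ℤ) (z : ℤ), (vbumps v ps z).length = v.length := by
  induction ps with
  | nil => intro v z; simp [vbumps]
  | cons p ps ih => intro v z; rw [vbumps, List.foldl_cons, ← vbumps, ih, length_vbump]

/-- `vbumps` adds `z · Σ_{p ∈ ps} ℓ p`. [folklore] -/
theorem vdot_vbumps (ps : List ℕ) : ∀ (v : List ℤ) (z : ℤ), (∀ p ∈ ps, p < v.length) →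
    vdot (vbumps v ps z) ℓ = vdot v ℓ + z * (ps.map ℓ).sum := by
  induction ps with
  | nil => intro v z _; simp [vbumps]
  | cons p ps ih =>
    intro v z h
    rw [vbumps, List.foldl_cons, ← vbumps, ih _ _ (fun q hq => by rw [length_vbump]; exact h q (by simp [hq])),
      vdot_vbump ℓ z (h p (by simp)), List.map_cons, List.sum_cons]
    ring

/-- The zero vector has length 21. [folklore] -/
theorem length_z21 : z21.length = 21 := by simp [z21]

/-- `vdot` of the zero vector. [folklore] -/
theorem vdot_z21 : vdot z21 ℓ = 0 := by
  simp [vdot, vdotFrom, z21, List.replicate]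

/-- `vAdd` on equal lengths keeps the length. [folklore] -/
theorem length_vAdd {v w : List ℤ} (h : v.length = w.length) : (vAdd v w).length = v.length := by
  simp [vAdd, List.length_zipWith, h]

/-- `vAdd` is additive on equal lengths. [folklore] -/
theorem vdotFrom_vAdd : ∀ (v w : List ℤ) (k : ℕ), v.length = w.length →
    vdotFrom ℓ (vAdd v w) k = vdotFrom ℓ v k + vdotFrom ℓ w k
  | [], [], _, _ => by simp [vAdd, vdotFrom]
  | [], _ :: _, _, h => by simp at h
  | _ :: _, [], _, h => by simp at h
  | a :: v, b :: w, k, h => by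
    have h' : v.length = w.length := by simpa using h
    have := vdotFrom_vAdd v w (k + 1) h'
    simp only [vAdd, List.zipWith_cons_cons, vdotFrom] at this ⊢
    rw [this]; push_cast; ring

/-- `vAdd` is additive on equal lengths. [folklore] -/
theorem vdot_vAdd {v w : List ℤ} (h : v.length = w.length) : vdot (vAdd v w) ℓ = vdot v ℓ + vdot w ℓ :=
  vdotFrom_vAdd ℓ v w 0 h

/-- `vSmul` keeps the length. [folklore] -/
theorem length_vSmul (z : ℤ) (v : List ℤ) : (vSmul z v).length = v.length := by simp [vSmul]

/-- `vSmul` is homogeneous. [folklore] -/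
theorem vdotFrom_vSmul (z : ℤ) : ∀ (v : List ℤ) (k : ℕ), vdotFrom ℓ (vSmul z v) k = z * vdotFrom ℓ v k
  | [], _ => by simp [vSmul, vdotFrom]
  | a :: v, k => by
    have := vdotFrom_vSmul z v (k + 1)
    simp only [vSmul, List.map_cons, vdotFrom] at this ⊢
    rw [this]; push_cast; ring

/-- `vSmul` is homogeneous. [folklore] -/
theorem vdot_vSmul (z : ℤ) (v : List ℤ) : vdot (vSmul z v) ℓ = z * vdot v ℓ := vdotFrom_vSmul ℓ z v 0

/-- `vSum` is the sum of the entries. [folklore] -/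
theorem vSum_eq_sum : ∀ v : List ℤ, vSum v = ∑ i ∈ range v.length, v.getD i 0
  | [] => by simp [vSum]
  | a :: v => by
    rw [vSum, vSum_eq_sum v, List.length_cons, sum_range_succ']
    simp [add_comm]

/-- `suffixSums` keeps the length. [folklore] -/
theorem length_suffixSums : ∀ v : List ℤ, (suffixSums v).length = v.length
  | [] => by simp [suffixSums]
  | a :: v => by simp [suffixSums, length_suffixSums v]

/-- The entries of `suffixSums` are the suffix sums. [folklore] -/
theorem getD_suffixSums : ∀ (v : List ℤ) (i : ℕ), i < v.length →
    (suffixSums v).getD i 0 = ∑ t ∈ Ico i v.length, v.getD t 0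
  | [], i, h => by simp at h
  | a :: v, 0, _ => by
    rw [suffixSums, List.getD_cons_zero, List.length_cons, vSum_eq_sum, Finset.sum_Ico_eq_sum_range]
    simp only [tsub_zero, zero_add]
    rw [sum_range_succ']
    simp [add_comm]
  | a :: v, i + 1, h => by
    have h' : i < v.length := by simpa using h
    rw [suffixSums, List.getD_cons_succ, getD_suffixSums v i h', List.length_cons, ← Finset.sum_Ico_add']
    simp

/-- Value of a prefix form: `C_j(d) = Σ_{i<j} T_{i+1} · (E_{i+1}(d) − E_i(d))`. [folklore] -/
theorem ev_prefixForm (ord : List Atom) (T : List ℤ) : ∀ j : ℕ,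
    (prefixForm ord T j).ev d = ∑ i ∈ range j, T.getD (i + 1) 0 * ((Eform ord (i + 1)).ev d - (Eform ord i).ev d)
  | 0 => by simp [prefixForm, ev_ld0]
  | j + 1 => by
    rw [prefixForm, ev_ldAdd, ev_prefixForm ord T j, ev_ldSmul, sum_range_succ, pairForm, ev_ldSub]

/-! ## Sums of form weights -/

/-- `Σ_{(F, z) ∈ L} z · log F(d)`. [folklore] -/
noncomputable def fwSum (L : List (LinD × ℤ)) : ℝ := (L.map fun e => (e.2 : ℝ) * Real.log (e.1.ev d : ℝ)).sum

/-- `fwIns` adds one weighted logarithm. [folklore] -/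
theorem fwSum_fwIns : ∀ (L : List (LinD × ℤ)) (F : LinD) (z : ℤ),
    fwSum d (fwIns L F z) = fwSum d L + z * Real.log (F.ev d : ℝ)
  | [], F, z => by simp [fwIns, fwSum]
  | (G, y) :: L, F, z => by
    unfold fwIns
    split_ifs with h
    · subst h; simp [fwSum]; ring
    · have ih := fwSum_fwIns L F z
      simp only [fwSum, List.map_cons, List.sum_cons] at ih ⊢
      rw [ih]; ring

/-- The keys of `fwIns L F z` are `F` and the keys of `L`. [folklore] -/
theorem mem_fwIns : ∀ (L : List (LinD × ℤ)) (F : LinD) (z : ℤ) (e : LinD × ℤ),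
    e ∈ fwIns L F z → e.1 = F ∨ ∃ e' ∈ L, e'.1 = e.1
  | [], F, z, e, h => by simp [fwIns] at h; exact Or.inl (by rw [h])
  | (G, y) :: L, F, z, e, h => by
    unfold fwIns at h
    split_ifs at h with hG
    · rcases List.mem_cons.1 h with rfl | h
      · exact Or.inl hG
      · exact Or.inr ⟨e, List.mem_cons_of_mem _ h, rfl⟩
    · rcases List.mem_cons.1 h with rfl | h
      · exact Or.inr ⟨(G, y), by simp, rfl⟩
      · rcases mem_fwIns L F z e h with h1 | ⟨e', he', hee'⟩
        · exact Or.inl h1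
        · exact Or.inr ⟨e', List.mem_cons_of_mem _ he', hee'⟩

/-- A weight list with non-negative weights on keys of value `≥ 1` has a non-negative sum. [folklore] -/
theorem fwSum_nonneg {L : List (LinD × ℤ)} (hw : ∀ e ∈ L, 0 ≤ e.2) (hk : ∀ e ∈ L, 1 ≤ e.1.ev d) : 0 ≤ fwSum d L := by
  unfold fwSum
  refine List.sum_nonneg ?_
  intro x hx
  rw [List.mem_map] at hx
  obtain ⟨e, he, rfl⟩ := hx
  have h1 : (1 : ℝ) ≤ (e.1.ev d : ℝ) := by exact_mod_cast hk e he
  exact mul_nonneg (by exact_mod_cast hw e he) (Real.log_nonneg h1)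



/-! ## Abel summation for a balanced weight vector -/

/-- Re-indexing a pairing by suffix sums:
`Σ_{t ≤ n} b_t A_t = A_0 · Σ_{t ≤ n} b_t + Σ_{i < n} (Σ_{i < t ≤ n} b_t) · (A_{i+1} − A_i)`. [folklore] -/
theorem sum_mul_eq_suffix (b A : ℕ → ℝ) (n : ℕ) :
    ∑ t ∈ range (n + 1), b t * A t =
      A 0 * ∑ t ∈ range (n + 1), b t + ∑ i ∈ range n, (∑ t ∈ Ico (i + 1) (n + 1), b t) * (A (i + 1) - A i) := by
  have hswap : ∑ i ∈ range n, (∑ t ∈ Ico (i + 1) (n + 1), b t) * (A (i + 1) - A i)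
      = ∑ t ∈ range (n + 1), b t * (A t - A 0) := by
    calc ∑ i ∈ range n, (∑ t ∈ Ico (i + 1) (n + 1), b t) * (A (i + 1) - A i)
        = ∑ i ∈ range n, ∑ t ∈ Ico (i + 1) (n + 1), b t * (A (i + 1) - A i) := by
          simp_rw [Finset.sum_mul]
      _ = ∑ t ∈ range (n + 1), ∑ i ∈ range t, b t * (A (i + 1) - A i) :=
          Finset.sum_comm' (fun i t => by simp only [mem_range, mem_Ico]; omega)
      _ = ∑ t ∈ range (n + 1), b t * (A t - A 0) := by
          refine sum_congr rfl fun t _ => ?_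
          rw [← Finset.mul_sum, Finset.sum_range_sub]
  rw [hswap, Finset.mul_sum, ← Finset.sum_add_distrib]
  exact sum_congr rfl fun t _ => by ring

/-- **Abel step.**  Points `(E_t, A_t)`, `t ≤ 20`, in concave position; weights `b` with `Σ_{t ≤ 20} b_t = 0`, Abel prefix sums
`C_j = Σ_{i<j} T_{i+1}(E_{i+1} − E_i)` (`T_{i+1} = Σ_{i<t≤20} b_t`) with `C_j ≤ 0` for `1 ≤ j ≤ 19` and `C_20 = 0`.  Then
`Σ b_t A_t ≤ 0`. [folklore] -/
theorem abel_nonpos (A E b : ℕ → ℝ) (hE : ∀ i, i < 20 → E i < E (i + 1))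
    (hconc : ∀ t, 1 ≤ t → t ≤ 19 → (E (t + 1) - E t) * (A (t - 1) - A t) + (E t - E (t - 1)) * (A (t + 1) - A t) ≤ 0)
    (hsum : ∑ t ∈ range 21, b t = 0)
    (hC : ∀ j, 1 ≤ j → j ≤ 19 → ∑ i ∈ range j, (∑ t ∈ Ico (i + 1) 21, b t) * (E (i + 1) - E i) ≤ 0)
    (hC20 : ∑ i ∈ range 20, (∑ t ∈ Ico (i + 1) 21, b t) * (E (i + 1) - E i) = 0) :
    ∑ t ∈ range 21, b t * A t ≤ 0 := by
  -- suffix sums, gaps, slopes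
  set T : ℕ → ℝ := fun i => ∑ t ∈ Ico (i + 1) 21, b t with hT
  set g : ℕ → ℝ := fun i => E (i + 1) - E i with hg
  set sl : ℕ → ℝ := fun i => (A (i + 1) - A i) / g i with hsl
  have hgpos : ∀ i, i < 20 → 0 < g i := fun i hi => by simp only [hg]; linarith [hE i hi]
  have hδ : ∀ i, i < 20 → A (i + 1) - A i = sl i * g i := fun i hi => by
    simp only [hsl]; rw [div_mul_cancel₀ _ (hgpos i hi).ne']
  -- (1) re-index by suffix sums
  have h1 : ∑ t ∈ range 21, b t * A t = ∑ i ∈ range 20, sl i * (T i * g i) := by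
    rw [sum_mul_eq_suffix b A 20, hsum, mul_zero, zero_add]
    refine sum_congr rfl fun i hi => ?_
    rw [hδ i (mem_range.1 hi)]; ring
  -- (2) slopes are non-increasing
  have hslmono : ∀ i, i < 19 → sl (i + 1) ≤ sl i := by
    intro i hi
    have hc := hconc (i + 1) (by omega) (by omega)
    simp only [Nat.add_sub_cancel] at hc
    have hgi := hgpos i (by omega)
    have hgi1 := hgpos (i + 1) (by omega)
    simp only [hsl]
    rw [div_le_div_iff₀ hgi1 hgi]
    simp only [hg] at hgi hgi1 ⊢
    nlinarith
  -- (3) Abel summation by parts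
  have h3 := Finset.sum_range_by_parts sl (fun i => T i * g i) 20
  simp only [smul_eq_mul] at h3
  have hC20' : ∑ i ∈ range 20, T i * g i = 0 := by simpa [hT, hg] using hC20
  rw [h1, h3, hC20', mul_zero, zero_sub]
  have h4 : 0 ≤ ∑ i ∈ range (20 - 1), (sl (i + 1) - sl i) * ∑ j ∈ range (i + 1), T j * g j := by
    refine sum_nonneg fun i hi => ?_
    have hi' : i < 19 := by simpa using hi
    have hCi : ∑ j ∈ range (i + 1), T j * g j ≤ 0 := by
      simpa [hT, hg] using hC (i + 1) (by omega) (by omega)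
    exact mul_nonneg_of_nonpos_of_nonpos (by linarith [hslmono i hi']) hCi
  linarith

/-! ## The checker's Abel conditions, evaluated at a support -/

variable (d : Fin 6 → ℕ)

/-- **Soundness of `abelOK`** at a support `d` where all context forms are non-negative: the vector `b` has 21 entries summing to
`0`, its prefix values `C_j(d)` (`E_i = ` value of the `i`-th pair-sum form) are `≤ 0` for `1 ≤ j ≤ 19`, and `C_20(d) = 0`. [folklore] -/
theorem abelOK_sound {ctx : List LinD} {ord : List Atom} {b : List ℤ} {fks : List Fk}
    (h : abelOK ctx ord b fks = true) (hctx : ∀ G ∈ ctx, 0 ≤ G.ev d) :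
    b.length = 21 ∧ (∑ t ∈ range 21, (b.getD t 0 : ℝ)) = 0 ∧
      (∀ j, 1 ≤ j → j ≤ 19 →
        ∑ i ∈ range j, (∑ t ∈ Ico (i + 1) 21, (b.getD t 0 : ℝ)) *
          (((Eform ord (i + 1)).ev d : ℝ) - ((Eform ord i).ev d : ℝ)) ≤ 0) ∧
      ∑ i ∈ range 20, (∑ t ∈ Ico (i + 1) 21, (b.getD t 0 : ℝ)) *
          (((Eform ord (i + 1)).ev d : ℝ) - ((Eform ord i).ev d : ℝ)) = 0 := by
  unfold abelOK at h
  simp only [Bool.and_eq_true, decide_eq_true_eq, List.all_eq_true] at h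
  obtain ⟨⟨⟨⟨hlen, hsum⟩, h20⟩, hfl⟩, hall⟩ := h
  -- suffix sums as `Ico` sums
  have hT : ∀ i, i < 20 → ((suffixSums b).getD (i + 1) 0 : ℝ) = ∑ t ∈ Ico (i + 1) 21, (b.getD t 0 : ℝ) := by
    intro i hi
    rw [getD_suffixSums b (i + 1) (by omega), hlen]; push_cast; rfl
  -- prefix forms evaluated
  have hpre : ∀ j, j ≤ 20 → ((prefixForm ord (suffixSums b) j).ev d : ℝ) =
      ∑ i ∈ range j, (∑ t ∈ Ico (i + 1) 21, (b.getD t 0 : ℝ)) *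
        (((Eform ord (i + 1)).ev d : ℝ) - ((Eform ord i).ev d : ℝ)) := by
    intro j hj
    rw [ev_prefixForm]; push_cast
    exact sum_congr rfl fun i hi => by rw [hT i (by have := mem_range.1 hi; omega)]
  refine ⟨hlen, ?_, ?_, ?_⟩
  · have := vSum_eq_sum b
    rw [hsum, hlen] at this
    exact_mod_cast this.symm
  · intro j hj1 hj19
    have hmem : j - 1 ∈ List.range 19 := List.mem_range.2 (by omega)
    have hj := hall (j - 1) hmem
    have hlt : j - 1 < fks.length := by rw [hfl]; omega
    rw [List.getElem?_eq_getElem hlt] at hj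
    have hf := farkasOK_sound d hj hctx
    rw [show j - 1 + 1 = j by omega, ev_ldSmul] at hf
    have : ((prefixForm ord (suffixSums b) j).ev d : ℝ) ≤ 0 := by exact_mod_cast (by linarith : _)
    rwa [hpre j (by omega)] at this
  · have := hpre 20 le_rfl
    rw [h20, ev_ld0] at this
    exact_mod_cast this.symm

end Summit.ValiantsHypothesis.ValiantsHypothesis.Theorems.LacunarySymmetroidMatrixDescartes.Census.CU
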